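import Mathlib
import Literature.NumberTheory.LFunctions.Zhang2022.SkeletonPartTwo
import Literature.NumberTheory.LFunctions.Zhang2022.Section4GaussianWeight
import HarnessLib

/-!
# Zhang (2022) §4 (4.2)–(4.3) on the §11/§12 integrand `z ↦ g(P^z/y)`: Gaussian-tail bookkeeping

Topic `Literature/NumberTheory/LFunctions/Zhang2022` (Landau–Siegel audit tree; verdict-neutral).
Y. Zhang, *Discrete mean estimates and the Landau–Siegel zero*, arXiv:2211.02515v1 (2022)
[Zhang2022LandauSiegel] — **an unrefereed manuscript under adjudication** (campaign D-0069). The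
smoothed weights of §§11–12 (`g̃₁, g̃₂` p. 62, `H̃₁₅`'s dual weight p. 67) are `z`-integrals of
`g(P^z/y)` with `g` the Gaussian-smoothed step of (4.1) (`Skeleton.gW`, `Λ = 𝓛³⁰`), and the
manuscript's recurring claim "the terms with `n ≤ P^aη₋` or `n ≥ P^bη₊` contribute `≪ ε`" (p. 63
tex L3216 "By (5) and (5)", p. 67 tex L3434 "By (4) and (4)" — both references malformed in v1) rests
on nothing but (4.2)–(4.3). This file supplies that device once, kernel-checked from the tree's
`GaussWeight.abs_gWeight_sub_one_le` / `GaussWeight.gWeight_le` / `GaussWeight.gWeight_mono`: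

* `abs_gW_sub_one_le`: `z𝓛⁹ − log y ≥ 𝓛⁻¹⁰ ⇒ |g(P^z/y) − 1| ≤ ½e^{−𝓛¹⁰}` ((4.2), `𝓛³⁰·𝓛⁻²⁰ = 𝓛¹⁰`);
* `gW_le_exp`: `z𝓛⁹ − log y ≤ −u`, `u ≥ 𝓛⁻¹⁰ ⇒ 0 ≤ g(P^z/y) ≤ ½e^{−𝓛²⁰u}` ((4.3));
* `abs_integral_gW_sub_len_le`, `abs_integral_gW_le`: the same integrated over `[a, b]` (the
  integrand is monotone, hence interval-integrable: `intervalIntegrable_gW_rpow_div`);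
* `head_exponent_le`, `tail_exponent_le`: for `𝓛 ≥ 5` both regimes sit under the one summable
  majorant `e^{−𝓛¹⁰/2}·n⁻²` (`e^{−𝓛¹⁰}n² ≤ e^{−𝓛¹⁰/2}` for `log n ≤ 𝓛⁹`; `e^{−𝓛²⁰u}n² ≤ e^{−𝓛¹⁰/2}`
  for `log n ≥ a + 𝓛⁻¹⁰`, `a ≤ 𝓛⁹`), and `norm_tsum_le_of_hasSum`, `zeta_two_mul_exp_le`
  (`Σn⁻² = π²/6 ≤ 2`) turn a termwise bound into "`≪ ε`" with `c = 1/2`.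

Consumers: `Section11TailsClaim.lean` (node `Z22:§11.u005b`), the §12 dual-tails node (p. 67 L3434).

WHAT THIS IS NOT: any statement about the manuscript's Theorems 1–2 or about Landau–Siegel zeros;
elementary real analysis on the manuscript's own weight, 0 new facts.

## References

* Y. Zhang, arXiv:2211.02515v1 (2022), §4 (4.1)–(4.3); §11 pp. 62–63; §12 p. 67.
  [cite: Zhang2022LandauSiegel, §4 (4.2)–(4.3); §11 p. 63; §12 p. 67]
-/

noncomputable section

open Real Set MeasureTheory

namespace Literature.NumberTheory.LFunctions.Zhang2022.GaussTails

open Skeleton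

variable {D : ℕ}

/-! ## The integrand `z ↦ g(P^z/y)` (general `y > 0`) -/

/-- `P > 0`. [cite: Zhang2022LandauSiegel, §2 (2.6)] -/
theorem bigP_pos' (D : ℕ) : 0 < bigP D := Real.exp_pos _

/-- `log(P^z/y) = z𝓛⁹ − log y` (`y > 0`; `log P = 𝓛⁹`). [cite: Zhang2022LandauSiegel, §2 (2.6)] -/
theorem log_rpow_div {y : ℝ} (hy : 0 < y) (z : ℝ) :
    Real.log (bigP D ^ z / y) = z * ell D ^ 9 - Real.log y := by
  rw [Real.log_div (Real.rpow_pos_of_pos (bigP_pos' D) z).ne' hy.ne',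
    Real.log_rpow (bigP_pos' D), bigP, Real.log_exp]

/-- `log(P^a η_σ) = a𝓛⁹ + σ𝓛⁻¹⁰` (`η_± = exp{±𝓛⁻¹⁰}`, §11 p. 63). [cite: Zhang2022LandauSiegel, §11 p. 63] -/
theorem log_rpow_mul_etaPM (D : ℕ) (a σ : ℝ) :
    Real.log (bigP D ^ a * etaPM D σ) = a * ell D ^ 9 + σ * (ell D ^ 10)⁻¹ := by
  rw [etaPM, Real.log_mul (Real.rpow_pos_of_pos (bigP_pos' D) _).ne' (Real.exp_pos _).ne',
    Real.log_rpow (bigP_pos' D), bigP, Real.log_exp, Real.log_exp]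

/-- `P^a η_σ > 0`. [cite: Zhang2022LandauSiegel, §11 p. 63] -/
theorem rpow_mul_etaPM_pos (D : ℕ) (a σ : ℝ) : 0 < bigP D ^ a * etaPM D σ :=
  mul_pos (Real.rpow_pos_of_pos (bigP_pos' D) _) (Real.exp_pos _)

/-- The integrand `z ↦ g(P^z/y)` is increasing (`g` increasing, (4.1); `P ≥ 1`).
[cite: Zhang2022LandauSiegel, §4 (4.1)] -/
theorem monotone_gW_rpow_div (hL : 0 < ell D) {y : ℝ} (hy : 0 < y) :
    Monotone fun z : ℝ => gW D (bigP D ^ z / y) := by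
  intro z₁ z₂ hz
  have h1 : 1 ≤ bigP D := by rw [bigP]; exact Real.one_le_exp (pow_nonneg hL.le 9)
  simp only [gW]
  exact GaussWeight.gWeight_mono (pow_pos hL 30) (div_pos (Real.rpow_pos_of_pos (bigP_pos' D) _) hy)
    (div_le_div_of_nonneg_right (Real.rpow_le_rpow_of_exponent_le h1 hz) hy.le)

/-- Hence the integrand is integrable on every interval. [cite: Zhang2022LandauSiegel, §4 (4.1)] -/
theorem intervalIntegrable_gW_rpow_div (hL : 0 < ell D) {y : ℝ} (hy : 0 < y) (a b : ℝ) :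
    IntervalIntegrable (fun z : ℝ => gW D (bigP D ^ z / y)) volume a b :=
  ((monotone_gW_rpow_div hL hy).monotoneOn _).intervalIntegrable

/-- **(4.2) on the integrand**: if `z𝓛⁹ − log y ≥ 𝓛⁻¹⁰` then `|g(P^z/y) − 1| ≤ ½e^{−𝓛¹⁰}`
(`𝓛³⁰·(𝓛⁻¹⁰)² = 𝓛¹⁰`). [cite: Zhang2022LandauSiegel, §4 (4.2)] -/
theorem abs_gW_sub_one_le (hL : 0 < ell D) {y : ℝ} (hy : 0 < y) {z : ℝ}
    (hz : (ell D ^ 10)⁻¹ ≤ z * ell D ^ 9 - Real.log y) :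
    |gW D (bigP D ^ z / y) - 1| ≤ 1 / 2 * Real.exp (-ell D ^ 10) := by
  have hΛ : 0 < ell D ^ 30 := pow_pos hL 30
  have hx0 : 0 < bigP D ^ z / y := div_pos (Real.rpow_pos_of_pos (bigP_pos' D) _) hy
  have hv : 0 < (ell D ^ 10)⁻¹ := inv_pos.mpr (pow_pos hL 10)
  have hlog0 : (ell D ^ 10)⁻¹ ≤ Real.log (bigP D ^ z / y) := by rw [log_rpow_div hy z]; exact hz
  have hx1 : 1 ≤ bigP D ^ z / y := by
    calc (1 : ℝ) = Real.exp 0 := Real.exp_zero.symm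
      _ ≤ Real.exp (Real.log (bigP D ^ z / y)) := Real.exp_le_exp.mpr (by linarith)
      _ = bigP D ^ z / y := Real.exp_log hx0
  rw [gW]
  refine (GaussWeight.abs_gWeight_sub_one_le hΛ hx1).trans ?_
  have hsq : (ell D ^ 10)⁻¹ ^ 2 ≤ Real.log (bigP D ^ z / y) ^ 2 := pow_le_pow_left₀ hv.le hlog0 2
  have h30 : ell D ^ 30 * (ell D ^ 10)⁻¹ ^ 2 = ell D ^ 10 := by field_simp
  have hmul : ell D ^ 30 * (ell D ^ 10)⁻¹ ^ 2 ≤ ell D ^ 30 * Real.log (bigP D ^ z / y) ^ 2 :=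
    mul_le_mul_of_nonneg_left hsq hΛ.le
  gcongr
  linarith

/-- **(4.3) on the integrand**: if `z𝓛⁹ − log y ≤ −u` with `u ≥ 𝓛⁻¹⁰` then
`0 ≤ g(P^z/y) ≤ ½e^{−𝓛²⁰u}` (`𝓛³⁰u² ≥ 𝓛³⁰·𝓛⁻¹⁰·u`). [cite: Zhang2022LandauSiegel, §4 (4.3)] -/
theorem gW_le_exp (hL : 0 < ell D) {y : ℝ} (hy : 0 < y) {z u : ℝ}
    (hu : (ell D ^ 10)⁻¹ ≤ u) (hz : z * ell D ^ 9 - Real.log y ≤ -u) :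
    0 ≤ gW D (bigP D ^ z / y) ∧ gW D (bigP D ^ z / y) ≤ 1 / 2 * Real.exp (-(ell D ^ 20 * u)) := by
  have hΛ : 0 < ell D ^ 30 := pow_pos hL 30
  have hx0 : 0 < bigP D ^ z / y := div_pos (Real.rpow_pos_of_pos (bigP_pos' D) _) hy
  have hv : 0 < (ell D ^ 10)⁻¹ := inv_pos.mpr (pow_pos hL 10)
  have hu0 : 0 < u := lt_of_lt_of_le hv hu
  have hlogle : Real.log (bigP D ^ z / y) ≤ -u := by rw [log_rpow_div hy z]; exact hz
  have hx1 : bigP D ^ z / y ≤ 1 := by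
    calc bigP D ^ z / y = Real.exp (Real.log (bigP D ^ z / y)) := (Real.exp_log hx0).symm
      _ ≤ Real.exp 0 := Real.exp_le_exp.mpr (by linarith)
      _ = 1 := Real.exp_zero
  rw [gW]
  refine ⟨(GaussWeight.gWeight_pos hΛ _).le, (GaussWeight.gWeight_le hΛ hx0 hx1).trans ?_⟩
  have hsq : u ^ 2 ≤ Real.log (bigP D ^ z / y) ^ 2 := by
    have h1 : u ≤ -Real.log (bigP D ^ z / y) := by linarith
    calc u ^ 2 ≤ (-Real.log (bigP D ^ z / y)) ^ 2 := pow_le_pow_left₀ hu0.le h1 2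
      _ = Real.log (bigP D ^ z / y) ^ 2 := by ring
  have hu2 : (ell D ^ 10)⁻¹ * u ≤ u ^ 2 := by rw [sq]; exact mul_le_mul_of_nonneg_right hu hu0.le
  have h30 : ell D ^ 30 * ((ell D ^ 10)⁻¹ * u) = ell D ^ 20 * u := by field_simp
  have hmul : ell D ^ 30 * ((ell D ^ 10)⁻¹ * u) ≤ ell D ^ 30 * Real.log (bigP D ^ z / y) ^ 2 :=
    mul_le_mul_of_nonneg_left (hu2.trans hsq) hΛ.le
  gcongr
  linarith

/-- **Head integral**: if `a𝓛⁹ − log y ≥ 𝓛⁻¹⁰` and `a ≤ b`, then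
`|∫_a^b g(P^z/y)dz − (b − a)| ≤ ½e^{−𝓛¹⁰}(b − a)` ((4.2) pointwise on `(a, b]`).
[cite: Zhang2022LandauSiegel, §4 (4.2); §11 p. 63] -/
theorem abs_integral_gW_sub_len_le (hL : 0 < ell D) {y : ℝ} (hy : 0 < y) {a b : ℝ} (hab : a ≤ b)
    (ha : (ell D ^ 10)⁻¹ ≤ a * ell D ^ 9 - Real.log y) :
    |(∫ z in a..b, gW D (bigP D ^ z / y)) - (b - a)| ≤ 1 / 2 * Real.exp (-ell D ^ 10) * (b - a) := by
  have heq : (∫ z in a..b, gW D (bigP D ^ z / y)) - (b - a) =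
      ∫ z in a..b, (gW D (bigP D ^ z / y) - 1) := by
    rw [intervalIntegral.integral_sub (intervalIntegrable_gW_rpow_div hL hy a b)
      intervalIntegrable_const, intervalIntegral.integral_const, smul_eq_mul, mul_one]
  rw [heq]
  have h := intervalIntegral.norm_integral_le_of_norm_le_const (a := a) (b := b)
    (C := 1 / 2 * Real.exp (-ell D ^ 10)) (f := fun z => gW D (bigP D ^ z / y) - 1)
    (fun z hz => by
      rw [Set.uIoc_of_le hab, Set.mem_Ioc] at hz
      rw [Real.norm_eq_abs]
      apply abs_gW_sub_one_le hL hy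
      have : a * ell D ^ 9 ≤ z * ell D ^ 9 := mul_le_mul_of_nonneg_right hz.1.le (pow_pos hL 9).le
      linarith)
  rw [Real.norm_eq_abs, abs_of_nonneg (sub_nonneg.mpr hab)] at h
  exact h

/-- **Tail integral**: if `b𝓛⁹ − log y ≤ −u`, `u ≥ 𝓛⁻¹⁰` and `a ≤ b`, then
`|∫_a^b g(P^z/y)dz| ≤ ½e^{−𝓛²⁰u}(b − a)` ((4.3) pointwise on `(a, b]`).
[cite: Zhang2022LandauSiegel, §4 (4.3); §11 p. 63] -/
theorem abs_integral_gW_le (hL : 0 < ell D) {y : ℝ} (hy : 0 < y) {a b u : ℝ} (hab : a ≤ b)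
    (hu : (ell D ^ 10)⁻¹ ≤ u) (hb : b * ell D ^ 9 - Real.log y ≤ -u) :
    |∫ z in a..b, gW D (bigP D ^ z / y)| ≤ 1 / 2 * Real.exp (-(ell D ^ 20 * u)) * (b - a) := by
  have h := intervalIntegral.norm_integral_le_of_norm_le_const (a := a) (b := b)
    (C := 1 / 2 * Real.exp (-(ell D ^ 20 * u))) (f := fun z => gW D (bigP D ^ z / y))
    (fun z hz => by
      rw [Set.uIoc_of_le hab, Set.mem_Ioc] at hz
      have : z * ell D ^ 9 ≤ b * ell D ^ 9 := mul_le_mul_of_nonneg_right hz.2 (pow_pos hL 9).le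
      obtain ⟨h0, h1⟩ := gW_le_exp hL hy hu (show z * ell D ^ 9 - Real.log y ≤ -u by linarith)
      rw [Real.norm_eq_abs, abs_of_nonneg h0]
      exact h1)
  rw [Real.norm_eq_abs, abs_of_nonneg (sub_nonneg.mpr hab)] at h
  exact h

/-! ## Large-`𝓛` bookkeeping: one summable majorant `e^{−𝓛¹⁰/2}·n⁻²` for both regimes -/

/-- **Head exponent**: for `𝓛 ≥ 5`, `a ≤ 𝓛⁹` and `log y ≤ a`: `−𝓛¹⁰ + 2log y ≤ −𝓛¹⁰/2`
(i.e. `e^{−𝓛¹⁰}·y² ≤ e^{−𝓛¹⁰/2}`) — the head regime of the "`≪ ε`" claims p. 63 / p. 67.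
[cite: Zhang2022LandauSiegel, §11 p. 63] -/
theorem head_exponent_le {L a ly : ℝ} (hL : 5 ≤ L) (ha : a ≤ L ^ 9) (h : ly ≤ a) :
    -L ^ 10 + 2 * ly ≤ -(L ^ 10 / 2) := by
  have hL9 : 0 ≤ L ^ 9 := by positivity
  have hL10 : 5 * L ^ 9 ≤ L ^ 10 := by
    calc 5 * L ^ 9 = L ^ 9 * 5 := by ring
      _ ≤ L ^ 9 * L := mul_le_mul_of_nonneg_left hL hL9
      _ = L ^ 10 := by ring
  linarith

/-- **Tail exponent**: for `𝓛 ≥ 5`, `a ≤ 𝓛⁹` and `log y ≥ a + 𝓛⁻¹⁰`: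
`−𝓛²⁰(log y − a) + 2log y ≤ −𝓛¹⁰/2` (i.e. `e^{−𝓛²⁰u}·y² ≤ e^{−𝓛¹⁰/2}`; `𝓛²⁰·𝓛⁻¹⁰ = 𝓛¹⁰`) — the tail
regime of the "`≪ ε`" claims p. 63 / p. 67. [cite: Zhang2022LandauSiegel, §11 p. 63] -/
theorem tail_exponent_le {L a ly : ℝ} (hL : 5 ≤ L) (ha : a ≤ L ^ 9)
    (h : a + (L ^ 10)⁻¹ ≤ ly) : -(L ^ 20 * (ly - a)) + 2 * ly ≤ -(L ^ 10 / 2) := by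
  have hL0 : 0 < L := by linarith
  have hL9 : (5 : ℝ) ^ 9 ≤ L ^ 9 := pow_le_pow_left₀ (by norm_num) hL 9
  have hL10 : 5 * L ^ 9 ≤ L ^ 10 := by
    calc 5 * L ^ 9 = L ^ 9 * 5 := by ring
      _ ≤ L ^ 9 * L := mul_le_mul_of_nonneg_left hL (by positivity)
      _ = L ^ 10 := by ring
  have hL20 : (2 : ℝ) ≤ L ^ 20 := by
    have : (5 : ℝ) ^ 20 ≤ L ^ 20 := pow_le_pow_left₀ (by norm_num) hL 20
    norm_num at this
    linarith
  set v : ℝ := (L ^ 10)⁻¹ with hv_def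
  have hv1 : v ≤ 1 := by
    rw [hv_def]
    apply inv_le_one_of_one_le₀
    nlinarith
  have hLv : L ^ 20 * v = L ^ 10 := by rw [hv_def]; field_simp
  set w : ℝ := ly - a - v with hw_def
  have hw : 0 ≤ w := by rw [hw_def]; linarith
  have hkey : L ^ 20 * (ly - a) = L ^ 10 + L ^ 20 * w := by rw [hw_def, ← hLv]; ring
  have hqw : 2 * w ≤ L ^ 20 * w := mul_le_mul_of_nonneg_right hL20 hw
  have hly : ly = w + a + v := by rw [hw_def]; ring
  rw [hkey, hly]
  norm_num at hL9
  nlinarith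

/-- `e^{−𝓛¹⁰/2} = e^{−(1/2)𝓛¹⁰}` and `(π²/6)·X ≤ 2X` for `X ≥ 0`: the shape of the final constant
`C·exp{−c𝓛¹⁰}` of "`≪ ε`" (§4 p. 20). [cite: Zhang2022LandauSiegel, §11 p. 63] -/
theorem zeta_two_mul_exp_le (L : ℝ) :
    Real.exp (-(L ^ 10 / 2)) * (π ^ 2 / 6) ≤ 2 * Real.exp (-(1 / 2) * L ^ 10) := by
  have hπ : π ^ 2 / 6 ≤ 2 := by nlinarith [Real.pi_lt_d2, Real.pi_pos]
  have hE : Real.exp (-(L ^ 10 / 2)) = Real.exp (-(1 / 2) * L ^ 10) := by ring_nf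
  rw [hE]
  nlinarith [Real.exp_pos (-(1 / 2) * L ^ 10)]

/-- Comparison: a series in `ℂ` dominated termwise by a real series with sum `A` has norm `≤ A`
(in particular it converges absolutely) — how "the terms … contribute `≪ ε`" is read for the series
`J̃₁`. [cite: Zhang2022LandauSiegel, §11 p. 63] -/
theorem norm_tsum_le_of_hasSum {f : ℕ → ℂ} {M : ℕ → ℝ} {A : ℝ} (hM : HasSum M A)
    (h : ∀ n, ‖f n‖ ≤ M n) : ‖∑' n, f n‖ ≤ A := by
  have hfs : Summable fun n => ‖f n‖ :=
    Summable.of_nonneg_of_le (fun n => norm_nonneg _) h hM.summable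
  exact (norm_tsum_le_tsum_norm hfs).trans (hasSum_le h hfs.hasSum hM)

/-- `|ψχ(n)| ≤ 1`. [cite: Zhang2022LandauSiegel, §2 (2.23)] -/
theorem norm_pc_le_one [NeZero D] (χ : DirichletCharacter ℂ D) (x : Chr D) (n : ℕ) :
    ‖pc χ x n‖ ≤ 1 := by
  rw [pc, norm_mul]
  exact mul_le_one₀ (DirichletCharacter.norm_le_one _ _) (norm_nonneg _)
    (DirichletCharacter.norm_le_one _ _)

/-- `n² = e^{2 log n}` for `n ≥ 1` (passage to the majorant `n⁻²`). [cite: Zhang2022LandauSiegel, §11 p. 63] -/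
theorem natCast_sq_eq_exp {n : ℕ} (hn : 0 < n) : ((n : ℝ)) ^ 2 = Real.exp (2 * Real.log n) := by
  have hl : Real.log ((n : ℝ) ^ 2) = 2 * Real.log n := by rw [Real.log_pow]; push_cast; ring
  have hn0 : (0 : ℝ) < n := by exact_mod_cast hn
  rw [← hl, Real.exp_log (by positivity)]

/-- `D ≥ ⌈e⁵⌉` gives `𝓛 = log D ≥ 5` ("`D` sufficiently large", §2 p. 4). [cite: Zhang2022LandauSiegel, §2 p. 4] -/
theorem five_le_ell (hD : ⌈Real.exp 5⌉₊ ≤ D) : 5 ≤ ell D := by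
  have hexp : Real.exp 5 ≤ D := le_trans (Nat.le_ceil _) (by exact_mod_cast hD)
  exact (Real.le_log_iff_exp_le (lt_of_lt_of_le (Real.exp_pos _) hexp)).mpr hexp

end Literature.NumberTheory.LFunctions.Zhang2022.GaussTails
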